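import Literature.AlgebraicTopology.CharacteristicClasses.ProjectiveBundleLine
import Literature.AlgebraicTopology.CharacteristicClasses.ProjectiveSpaceLerayHirsch
import Literature.AlgebraicTopology.SingularHomology.LerayHirschGlobal
import HarnessLib

/-!
# The Leray–Hirsch theorem for projective bundles: `H*(P(ξ))` is free over `H*(B)` on `1, x, …, xⁿ⁻¹`

D. Husemoller, *Fibre Bundles* (3rd ed. 1994), Ch. 17 §2 Thm. 2.5 ("the classes
`1, a_ξ, …, a_ξⁿ⁻¹` form a base of the `H*(B)`-module `H*(E(Pξ))`"), deduced from the
Leray–Hirsch Thm. 1.1 since restricted to each fibre `ℙ(F)` they generate its cohomology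
(Thm. 2.3). Here,
for a complex vector bundle `E` of rank `n ≥ 1` over a paracompact Hausdorff base, `P(E) = E.Proj`,
`q = E.projMap` and `x = e(λ) ∈ H²(P(E); R)` (`ProjectiveBundleLine.lineEuler`):

* **`projectiveBundle_lerayHirsch`**: `(aⱼ)_{j<n} ↦ Σⱼ q^*aⱼ ⌣ xʲ : Π_{2j ≤ k} Hᵏ⁻²ʲ(B) → Hᵏ(P(E))`
  is bijective for every `k`.

Proof: the Leray–Hirsch engine `LerayHirschGlobal.bijective_of_cover` over the cover of `B` by
open sets `U_b` whose closures `K_b` lie in trivialising charts; over an open `W ⊆ K_b`,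
`P(E)_W ≅ W × ℙ(F)` (`Trivialization.preimageHomeomorph` of the projectivised chart) carries
`x|` to `pr₂^* x_F` EXACTLY (`map_incl_lineEuler`, which needs `K_b` closed), and
`H*(W × ℙ(F))` is free on the `pr₂^* x_Fʲ` for every `W` (`projectiveSpace_lerayHirsch`).
Everything is proved; no named facts.

## References

* D. Husemoller, *Fibre Bundles*, GTM 20, Springer 1994, Ch. 17 §1 Thm. 1.1, §2 Thm. 2.5. [HusemollerFibreBundles1994]
* A. Hatcher, *Algebraic Topology*, CUP 2002, §4.D Thm. 4D.1. [HatcherAT2002]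
-/

noncomputable section

open CategoryTheory Function Set Bundle Module Literature.AlgebraicTopology.SingularHomology
  Literature.AlgebraicTopology.SingularHomology.LerayHirsch
open scoped LinearAlgebra.Projectivization Topology

namespace Literature.AlgebraicTopology.CharacteristicClasses

open ComplexVectorBundle

/-- `LH(V, dim V)` (the induction of `projectiveSpace_lerayHirsch`, indexed by the dimension itself). [cite: HusemollerFibreBundles1994, Ch. 17 §2 Thm. 2.5] -/
theorem isProjLH_finrank (R : Type) [CommRing R] (V : Type) [NormedAddCommGroup V] [NormedSpace ℂ V] [FiniteDimensional ℂ V]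
    (h : 0 < finrank ℂ V) : IsProjLH R V (finrank ℂ V) := by
  obtain ⟨n, hn⟩ := Nat.exists_eq_succ_of_ne_zero h.ne'
  rw [hn]
  exact projectiveSpace_lerayHirsch R n V hn

namespace ComplexVectorBundle

variable {B : Type} [TopologicalSpace B] [T2Space B] [ParacompactSpace B] (E : ComplexVectorBundle.{0, 0} B)
  (k₀ : Fin E.rank) (R : Type) [CommRing R]

/-- **The Leray–Hirsch classes `xʲ ∈ H²ʲ(P(E); R)`, `j < n`**, `x = e(λ)`. [cite: HusemollerFibreBundles1994, Ch. 17 §2 Thm. 2.5] -/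
def projBundleCls (j : Fin E.rank) : singularCohomology R R E.Proj (evenDeg E.rank j) := cupPow R (E.lineEuler k₀ R 1) j

/-! ### The local input over a closed chart set -/

section Local

variable {E} (i : B) {K W : Set B} (hK : K ⊆ (E.triv i).baseSet) (hKc : IsClosed K) (hW : W ⊆ K)

omit [T2Space B] [ParacompactSpace B] in
/-- `q⁻¹W` for `q = E.projMap` is `proj⁻¹W`. [folklore] -/
theorem preimage_projMap (W : Set B) : (E.projMap ⁻¹' W : Set E.Proj) = TotalSpace.proj ⁻¹' W := rfl

/-- The trivialising homeomorphism `P(E)_W ≅ W × ℙ(F)` of the projectivised chart `e_i`. [cite: HusemollerFibreBundles1994, Ch. 17 Def. 2.1] -/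
def projOverHomeomorph : ↥(E.projMap ⁻¹' W) ≃ₜ ↥W × ℙ ℂ E.F :=
  (Homeomorph.setCongr (E.preimage_projMap W)).trans ((projTrivialization ℂ E.F E.E (E.triv i)).preimageHomeomorph (hW.trans hK))

omit [T2Space B] [ParacompactSpace B] in
/-- Its second component is the line in the frame `(i, 𝟙)`. [folklore] -/
theorem projOverHomeomorph_snd (p : ↥(E.projMap ⁻¹' W)) : (projOverHomeomorph i hK hW p).2 = E.lineIn (E.stdFrame i) p.1 := by
  rw [lineIn_eq_homeomorph]
  change (projTrivialization ℂ E.F E.E (E.triv i) p.1).2 =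
    homeomorphOfContinuousLinearEquiv (ContinuousLinearEquiv.refl ℂ E.F) (projTrivialization ℂ E.F E.E (E.triv i) p.1).2
  generalize (projTrivialization ℂ E.F E.E (E.triv i) p.1).2 = y
  induction y using Projectivization.ind with
  | h v hv => rfl

omit [T2Space B] [ParacompactSpace B] in
/-- It commutes with the projections: `pr₁ ∘ h = q|`. [folklore] -/
theorem fst_projOverHomeomorph (p : ↥(E.projMap ⁻¹' W)) : (projOverHomeomorph i hK hW p).1 = resMap E.projMap W p := by
  rw [projOverHomeomorph, Homeomorph.trans_apply, Trivialization.preimageHomeomorph_apply]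
  rfl

include hKc in
/-- **`x|_{P(E)_W} = h^*(pr₂^* x_F)`** for `W ⊆ K ⊆ U_i`, `K` closed. [cite: HusemollerFibreBundles1994, Ch. 17 §2] -/
theorem resCls_lineEuler_eq :
    singularCohomology.map R R (subsetIncl (E.projMap ⁻¹' W)) 2 (E.lineEuler k₀ R 1) =
      singularCohomology.map R R (projOverHomeomorph i hK hW : C(↥(E.projMap ⁻¹' W), ↥W × ℙ ℂ E.F)) 2
        (singularCohomology.map R R (ContinuousMap.snd : C(↥W × ℙ ℂ E.F, ℙ ℂ E.F)) 2 (tautEuler E.F R 1)) := by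
  -- factor the inclusion through `P(E)_K`
  let iWK : C(↥(E.projMap ⁻¹' W), ↥(E.ProjOver K)) := ⟨fun p ↦ ⟨p.1, hW p.2⟩, continuous_subtype_val.subtype_mk _⟩
  have hfac : subsetIncl (E.projMap ⁻¹' W) = (E.inclOver K).comp iWK := rfl
  have hsnd : (ContinuousMap.snd : C(↥W × ℙ ℂ E.F, ℙ ℂ E.F)).comp
      (projOverHomeomorph i hK hW : C(↥(E.projMap ⁻¹' W), ↥W × ℙ ℂ E.F)) = (E.lineMapOver i hK).comp iWK :=
    ContinuousMap.ext fun p ↦ projOverHomeomorph_snd i hK hW p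
  rw [hfac, singularCohomology.map_comp, ModuleCat.comp_apply, E.map_incl_lineEuler k₀ i hK R hKc 1, ← ModuleCat.comp_apply,
    ← singularCohomology.map_comp, ← hsnd, singularCohomology.map_comp, ModuleCat.comp_apply]

include hKc in
/-- The same for the powers `xʲ`. [folklore] -/
theorem map_symm_resCls_projBundleCls (j : Fin E.rank) :
    singularCohomology.map R R ((projOverHomeomorph i hK hW).symm : C(↥W × ℙ ℂ E.F, ↥(E.projMap ⁻¹' W))) (evenDeg E.rank j)
      (resCls E.projMap W (E.projBundleCls k₀ R) j) = projCls R E.F ↥W E.rank j := by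
  change singularCohomology.map R R _ (2 * (j : ℕ)) (singularCohomology.map R R _ (2 * (j : ℕ)) (cupPow R (E.lineEuler k₀ R 1) j)) =
    singularCohomology.map R R ContinuousMap.snd (2 * (j : ℕ)) (cupPow R (tautEuler E.F R 1) j)
  rw [map_cupPow, map_cupPow, map_cupPow, resCls_lineEuler_eq k₀ R i hK hKc hW, ← ModuleCat.comp_apply, ← singularCohomology.map_comp]
  congr 1
  rw [show (projOverHomeomorph i hK hW : C(↥(E.projMap ⁻¹' W), ↥W × ℙ ℂ E.F)).comp
      ((projOverHomeomorph i hK hW).symm : C(↥W × ℙ ℂ E.F, ↥(E.projMap ⁻¹' W))) = ContinuousMap.id _ from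
      ContinuousMap.ext fun p ↦ (projOverHomeomorph i hK hW).apply_symm_apply p, singularCohomology.map_id]
  rfl

include hK hKc hW in
/-- **The local input: `IsLH W` for `W ⊆ K ⊆ U_i`, `K` closed** (transport of `projectiveSpace_lerayHirsch`).
[cite: HusemollerFibreBundles1994, Ch. 17 §2 Thm. 2.5 (proof)] -/
theorem isLH_of_subset_closed : IsLH R (evenDeg E.rank) E.projMap (E.projBundleCls k₀ R) W := by
  have hrank : 0 < E.rank := k₀.pos
  refine (bijective_iff_of_homeomorph R (evenDeg E.rank) (resMap E.projMap W) (ContinuousMap.fst : C(↥W × ℙ ℂ E.F, ↥W))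
    (projOverHomeomorph i hK hW).symm (Homeomorph.refl ↥W) ?_ (resCls E.projMap W (E.projBundleCls k₀ R))
    (projCls R E.F ↥W E.rank) (map_symm_resCls_projBundleCls k₀ R i hK hKc hW)).2 (isProjLH_finrank R E.F hrank ↥W)
  ext1 p
  apply (Homeomorph.refl ↥W).symm.injective
  change resMap E.projMap W ((projOverHomeomorph i hK hW).symm p) = p.1
  rw [← fst_projOverHomeomorph i hK hW, Homeomorph.apply_symm_apply]

end Local

/-! ### The theorem -/

/-- A closed chart neighbourhood of `b`: `K_b ∈ 𝓝 b` closed with `K_b ⊆ U_b` (regularity of the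
paracompact Hausdorff base). [folklore] -/
theorem exists_closed_chart_nhds (b : B) : ∃ K : Set B, K ∈ 𝓝 b ∧ IsClosed K ∧ K ⊆ (E.triv b).baseSet :=
  exists_mem_nhds_isClosed_subset ((E.triv b).open_baseSet.mem_nhds (FiberBundle.mem_baseSet_trivializationAt' b))

/-- The chosen closed chart neighbourhoods. [folklore] -/
def chartNhd (b : B) : Set B := (E.exists_closed_chart_nhds b).choose

/-- Their properties. [folklore] -/
theorem chartNhd_spec (b : B) : E.chartNhd b ∈ 𝓝 b ∧ IsClosed (E.chartNhd b) ∧ E.chartNhd b ⊆ (E.triv b).baseSet :=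
  (E.exists_closed_chart_nhds b).choose_spec

/-- **The Leray–Hirsch theorem for the projective bundle** (Husemoller Thm. 2.5): for `E` of rank
`n ≥ 1` over a paracompact Hausdorff base, `(aⱼ)_{j<n} ↦ Σⱼ q^*aⱼ ⌣ xʲ : Π_{2j ≤ k} Hᵏ⁻²ʲ(B; R) → Hᵏ(P(E); R)`
is bijective for every `k` (`x = e(λ)`). [cite: HusemollerFibreBundles1994, Ch. 17 §2 Thm. 2.5] -/
theorem projectiveBundle_lerayHirsch (k : ℕ) :
    Bijective (lhMap R (evenDeg E.rank) E.projMap (E.projBundleCls k₀ R) k) :=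
  bijective_of_cover R (evenDeg E.rank) E.projMap (E.projBundleCls k₀ R) (fun b ↦ interior (E.chartNhd b))
    (fun _ ↦ isOpen_interior)
    (eq_univ_of_forall fun b ↦ mem_iUnion.2 ⟨b, mem_interior_iff_mem_nhds.2 (E.chartNhd_spec b).1⟩)
    (fun b _ _ hW ↦ isLH_of_subset_closed k₀ R b (E.chartNhd_spec b).2.2 (E.chartNhd_spec b).2.1
      (hW.trans interior_subset)) k

include k₀ in
/-- In particular **`q^* : H*(B) → H*(P(E))` is injective** (the `j = 0` component of `θ`).
[cite: HusemollerFibreBundles1994, Ch. 17 §2 Thm. 2.5] -/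
theorem map_projMap_injective (k : ℕ) : Injective (singularCohomology.map R R E.projMap k) := by
  have hrank : 0 < E.rank := k₀.pos
  intro a a' h
  -- embed `a` as the source with only the `j = 0` component
  let ι₀ : singularCohomology R R B k → Src R (evenDeg E.rank) B k := fun x j ↦
    if hj : (j.1 : ℕ) = 0 then (by
      have e : k - evenDeg E.rank j.1 = k := by change k - 2 * (j.1 : ℕ) = k; rw [hj]; simp
      exact degCast R e.symm x) else 0
  have hθ : ∀ x, lhMap R (evenDeg E.rank) E.projMap (E.projBundleCls k₀ R) k (ι₀ x) = singularCohomology.map R R E.projMap k x := by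
    intro x
    rw [lhMap_apply, Finset.sum_eq_single (⟨0, hrank⟩ : Fin E.rank)]
    · rw [dif_pos (show evenDeg E.rank ⟨0, hrank⟩ ≤ k from Nat.zero_le _)]
      change cupProduct _ (singularCohomology.map R R E.projMap (k - 2 * 0) (ι₀ x ⟨⟨0, hrank⟩, _⟩)) (cupPow R (E.lineEuler k₀ R 1) 0) = _
      have h0 : ι₀ x ⟨⟨0, hrank⟩, Nat.zero_le _⟩ = degCast R (show k = k - 2 * 0 by simp) x := by
        change dite _ _ _ = _
        rw [dif_pos rfl]
      rw [h0, map_degCast, cupPow_zero, cupProduct_degCast_left R _ _ (Nat.add_zero k), cupProduct_one]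
    · intro j _ hj
      have hj0 : (j : ℕ) ≠ 0 := fun h0 ↦ hj (Fin.ext h0)
      split_ifs with h
      · have : ι₀ x ⟨j, h⟩ = 0 := by change dite _ _ _ = _; rw [dif_neg hj0]
        rw [this, map_zero, LinearMap.map_zero₂]
      · rfl
    · intro h; exact absurd (Finset.mem_univ _) h
  have hinj := (E.projectiveBundle_lerayHirsch k₀ R k).1
  have : ι₀ a = ι₀ a' := hinj (by rw [hθ, hθ, h])
  have h0 := congrFun this ⟨⟨0, hrank⟩, Nat.zero_le _⟩
  change dite _ _ _ = dite _ _ _ at h0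
  rw [dif_pos rfl, dif_pos rfl] at h0
  exact (degCast R _).injective h0

end ComplexVectorBundle

end Literature.AlgebraicTopology.CharacteristicClasses
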